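import Literature.AlgebraicGeometry.Motives.HodgeThetaSubalgebraSymplecticRankSixDichotomy
import Literature.AlgebraicGeometry.Motives.HodgeThetaSubalgebraSymplecticRankSixSkeleton
import Literature.AlgebraicGeometry.Motives.HodgeThetaSubalgebraSymplecticRankSixKilling
import Literature.AlgebraicGeometry.Motives.HodgeThetaSubalgebraSymplecticRankSixTraceForm
import Literature.AlgebraicGeometry.Motives.SpanCRationalRadicalDescent
import Literature.AlgebraicGeometry.Motives.HodgeImaginaryQuadraticRankFourExtraEndomorphisms
import HarnessLib

/-!
# The Θ-subalgebra theorem in rank six, PART 3c: `𝔤_ℂ = 𝔰𝔭₆` for a generic weight-one Hodge structure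

Family `hodge`, layer `Literature/AlgebraicGeometry/Motives`. Research context: cell `pub-hodge-ring2` (HONEST
FRAMING: research route conditional on HC_CM; not a corollary; Q11.4-sentence-2 already refuted in dim ≥ 3),
Literature lane, programme R13 «generic abelian threefolds» — the Lie step of Moonen–Zarhin 1999 (2.3) Type I(1)
(«`X` is an abelian 3-fold with `End⁰(X) = ℚ`. Then `Hg(X) = Sp(V,φ) ≅ Sp_{6,ℚ}`»), for an ARBITRARY admissible
rational Lie algebra. UNCONDITIONAL; theorems only, no definition, no named fact (D-0026), no `sorry`.

§0 (`SymplecticThetaSix.skeleton_radical`, abstract, over any complex `M`): in the E³-type skeleton branch of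
`core_dichotomy`, the invariant form `ψ(X,Z) = tr_M(XZ) − 2·tr_𝔊(ad X ∘ ad Z)` on `𝔊` has a nonzero radical
vector commuting with `T`, and its radical lies in the centraliser of `T` (assembly of PART 3a
`skeleton_levi/spectral/triple`, PART 3b `skeleton_killing`, PART 3b′ `skeleton_traceForm`; in fact
`Rad ψ = 𝔰 ≅ 𝔰𝔬₃`: `β = 2κ` on `𝔰`, `β = ¾κ` on `𝔞₁ ≅ 𝔰𝔩₂`).

THE STATEMENT (`SymplecticThetaSix.mem_spanC_of_skew`). Let `H` be an effective polarized weight-one `ℚ`-Hodge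
structure with `dim V = 6` and `End_Hdg(V) = ℚ`, `𝔤 ⊆ End_ℚ(V)` a bracket-closed subspace of `ψ`-skew operators
with a Hodge operator `Θ ∈ 𝔤_ℂ`. Then every `ψ_ℂ`-skew operator of `V_ℂ` lies in `𝔤_ℂ` (so `𝔤 = 𝔰𝔭(V,ψ)`,
`mem_iff_skew`). PROOF. `V_ℂ` is `𝔤`-irreducible (`SymplecticTheta.eq_bot_or_top_of_stable`), `dim V^{1,0} = 3`;
the dichotomy `SymplecticThetaSix.core_dichotomy` either gives `𝔲⁺ ⊕ 𝔤𝔩(V^{1,0}) ⊕ 𝔲⁻ ⊆ 𝔤_ℂ` (done as in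
rank four), or the E³-type skeleton. In the skeleton case the invariant form `Ψ = tr_{V_ℂ}(XZ) − 2κ_{𝔤_ℂ}(X,Z)`
on `𝔤_ℂ` takes rational values on `𝔤 × 𝔤` (`tr` and the Killing form commute with base change:
`killing_baseChange_rational`), has a nonzero radical vector (`skeleton_radical` (i)), hence a nonzero RATIONAL
radical vector `X ∈ 𝔤` (`spanC_exists_rational_radical`), which commutes with `Θ` (`skeleton_radical` (ii)),
so is a Hodge endomorphism, so is scalar (`End_Hdg = ℚ`), so is `0` (scalars are not `ψ`-skew) — contradiction.

## References

* [MoonenZarhin1999LowDim] B. Moonen, Yu. Zarhin, Hodge classes and Tate classes on simple abelian fourfolds,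
  Math. Ann. 315 (1999), §2 (2.3) [corpus: paper:arxiv-math_9901113 p0005 L84–L86], (2.5).
* [Deligne1982HodgeCycles] P. Deligne, Hodge cycles on abelian varieties, LNM 900 (1982), I §3 (proof of Prop. 3.4).
* [Humphreys1972] J. E. Humphreys, Introduction to Lie algebras and representation theory, GTM 9 (1972), §5.1.
* [HoffmanKunze1971LinearAlgebra] K. Hoffman, R. Kunze, Linear Algebra (1971), §1.4 (closing remark).
-/

noncomputable section

open scoped TensorProduct

namespace Literature.AlgebraicGeometry.Motives

namespace HodgeStructure

universe u

section Radical

variable {M : Type*} [AddCommGroup M] [Module ℂ M]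

/-- **The radical of `β − 2κ` on the E³-type skeleton** (PART 3b″ of the rank-six Θ-subalgebra theorem). In the
skeleton branch of `core_dichotomy`: (i) there is `S ∈ 𝔊`, `S ≠ 0`, `ST = TS`, with
`tr_M(SZ) = 2·tr_𝔊(ad S ∘ ad Z)` for all `Z ∈ 𝔊`; (ii) any `X ∈ 𝔊` with `tr_M(XZ) = 2·tr_𝔊(ad X ∘ ad Z)` for all
`Z ∈ 𝔊` commutes with `T`. [cite: MoonenZarhin1999LowDim, §2 (2.3), (2.5)];
[cite: Humphreys1972, §4.3, §5.1] -/
theorem SymplecticThetaSix.skeleton_radical [FiniteDimensional ℂ M] (ω : LinearMap.BilinForm ℂ M)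
    (hωnd : ω.Nondegenerate) (hωalt : ∀ x y, ω x y = -ω y x) (𝔊 : Submodule ℂ (Module.End ℂ M))
    (hbr : ∀ Y ∈ 𝔊, ∀ Z ∈ 𝔊, Y * Z - Z * Y ∈ 𝔊)
    (had : ∀ X ∈ 𝔊, ∀ Z ∈ 𝔊, (LinearMap.mulLeft ℂ X - LinearMap.mulRight ℂ X) Z ∈ 𝔊)
    (hskew : ∀ Z ∈ 𝔊, ∀ x y, ω (Z x) y + ω x (Z y) = 0)
    {T : Module.End ℂ M} (hT𝔊 : T ∈ 𝔊) (hTT : ∀ v, T (T v) = v) {P Q : Submodule ℂ M}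
    (hP : ∀ x ∈ P, T x = x) (hQ : ∀ x ∈ Q, T x = -x) (hPmem : ∀ v, (2 : ℂ)⁻¹ • (v + T v) ∈ P)
    (hQmem : ∀ v, (2 : ℂ)⁻¹ • (v - T v) ∈ Q)
    (hirr : ∀ U : Submodule ℂ M, (∀ Z ∈ 𝔊, ∀ u ∈ U, Z u ∈ U) → U = ⊥ ∨ U = ⊤)
    (hP3 : Module.finrank ℂ ↥P = 3)
    {B₀ C₁ : Module.End ℂ M} (hB₀𝔊 : B₀ ∈ 𝔊) (hB₀P : ∀ p ∈ P, B₀ p = 0) (hB₀im : ∀ v, B₀ v ∈ P)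
    (hC₁𝔊 : C₁ ∈ 𝔊) (hC₁Q : ∀ q ∈ Q, C₁ q = 0) (hC₁im : ∀ v, C₁ v ∈ Q)
    (hBC : ∀ p ∈ P, B₀ (C₁ p) = p) (hCB : ∀ q ∈ Q, C₁ (B₀ q) = q)
    (hlineS : ∀ B ∈ 𝔊, (∀ p ∈ P, B p = 0) → (∀ v, B v ∈ P) → ∃ c : ℂ, B = c • B₀)
    (hlineC : ∀ C ∈ 𝔊, (∀ q ∈ Q, C q = 0) → (∀ v, C v ∈ Q) → ∃ c : ℂ, C = c • C₁) :
    let ad : ∀ X : Module.End ℂ M, X ∈ 𝔊 → (↥𝔊 →ₗ[ℂ] ↥𝔊) :=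
      fun X hX => (LinearMap.mulLeft ℂ X - LinearMap.mulRight ℂ X).restrict (had X hX)
    ∃ (S : Module.End ℂ M) (hS : S ∈ 𝔊), S ≠ 0 ∧ S * T = T * S ∧
      (∀ (Z : Module.End ℂ M) (hZ : Z ∈ 𝔊),
        LinearMap.trace ℂ M (S * Z) = 2 * LinearMap.trace ℂ ↥𝔊 (ad S hS ∘ₗ ad Z hZ)) ∧
      (∀ (X : Module.End ℂ M) (hX : X ∈ 𝔊),
        (∀ (Z : Module.End ℂ M) (hZ : Z ∈ 𝔊),
          LinearMap.trace ℂ M (X * Z) = 2 * LinearMap.trace ℂ ↥𝔊 (ad X hX ∘ₗ ad Z hZ)) → X * T = T * X) := by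
  intro ad
  classical
  have hT : B₀ * C₁ - C₁ * B₀ = T := SymplecticThetaSix.skeleton_bracket hP hQ hPmem hQmem hB₀P hC₁Q hBC hCB
  -- PART 3a: the triple
  obtain ⟨S, hS𝔊, hSB, hSC, hS3⟩ := SymplecticThetaSix.skeleton_exists_nonNilpotent 𝔊 hbr hT𝔊 hTT hP hQ hPmem
    hQmem hirr hP3 hB₀𝔊 hB₀P hB₀im hC₁𝔊 hC₁Q hC₁im hBC hCB hlineS hlineC
  obtain ⟨e, he, pu, hpuP, pz, hpzP, pd, hpdP, hpu0, hpz0, hpd0, hSpu, hSpz, hSpd, hsuu, hsdd, hzu, hzd, hσ, hτ⟩ :=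
    SymplecticThetaSix.skeleton_spectral ω hωnd hωalt 𝔊 hskew hT𝔊 hP hQ hPmem hQmem hP3 hB₀P hB₀im hC₁𝔊 hC₁Q
      hBC hCB hS𝔊 hSB hSC hS3
  obtain ⟨E', hE'𝔊, F', hF'𝔊, hEB, hEC, hFB, hFC, -, hEpz, hEpd, hFpu, hFpz, hFpd, hspan𝔰, hSE, hSF, hEF⟩ :=
    SymplecticThetaSix.skeleton_triple ω hωnd hωalt 𝔊 hbr hskew hT𝔊 hTT hP hQ hPmem hQmem hirr hP3 hB₀𝔊 hB₀P
      hB₀im hC₁𝔊 hC₁Q hC₁im hBC hCB hlineS hlineC hS𝔊 hSB hSC he hpuP hpzP hpdP hpu0 hpz0 hpd0 hSpu hSpz hSpd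
      hsuu hsdd hzu hzd hσ hτ
  set σ := ω pu (C₁ pd) with hσdef
  set τ := ω pz (C₁ pz) with hτdef
  have hrr : σ * τ⁻¹ * (τ * σ⁻¹) = 1 := by field_simp
  -- commutation with `T`
  have hcommT : ∀ X : Module.End ℂ M, X * B₀ = B₀ * X → X * C₁ = C₁ * X → X * T = T * X := by
    intro X hXB hXC
    rw [← hT, mul_sub, sub_mul,
      show X * (B₀ * C₁) = B₀ * C₁ * X by rw [← mul_assoc, hXB, mul_assoc, hXC, ← mul_assoc],
      show X * (C₁ * B₀) = C₁ * B₀ * X by rw [← mul_assoc, hXC, mul_assoc, hXB, ← mul_assoc]]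
  have hST : S * T = T * S := hcommT S hSB hSC
  have hET : E' * T = T * E' := hcommT E' hEB hEC
  have hFT : F' * T = T * F' := hcommT F' hFB hFC
  -- the `𝔰𝔩₂` table of `𝔞₁ = ⟨C₁, T, B₀⟩`
  have hBB : B₀ * B₀ = 0 := by ext v; exact hB₀P _ (hB₀im v)
  have hCC : C₁ * C₁ = 0 := by ext v; exact hC₁Q _ (hC₁im v)
  have hCBC : C₁ * B₀ * C₁ = C₁ := by ext v; exact hCB _ (hC₁im v)
  have hBCB : B₀ * C₁ * B₀ = B₀ := by ext v; exact hBC _ (hB₀im v)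
  have hC₁T : C₁ * T - T * C₁ = (2 : ℂ) • C₁ := by
    rw [← hT, mul_sub, sub_mul, ← mul_assoc, ← mul_assoc, hCC, zero_mul, hCBC, mul_assoc, hCC, mul_zero]
    module
  have hC₁B₀ : C₁ * B₀ - B₀ * C₁ = -T := by rw [← hT]; abel
  have hTB₀ : T * B₀ - B₀ * T = (2 : ℂ) • B₀ := by
    rw [← hT, mul_sub, sub_mul, mul_assoc C₁ B₀ B₀, hBB, mul_zero, hBCB, ← mul_assoc B₀ B₀ C₁, hBB, zero_mul,
      ← mul_assoc B₀ C₁ B₀, hBCB]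
    module
  -- every element of `𝔊` in the basis `C₁, T, B₀, S, E′, F′`
  have hPne : P ≠ ⊥ := fun h => by
    rw [h, finrank_bot] at hP3
    exact absurd hP3 (by norm_num)
  have hspan : ∀ Z ∈ 𝔊, ∃ c y b x u v : ℂ, Z = c • C₁ + y • T + b • B₀ + x • S + u • E' + v • F' := by
    intro Z hZ
    obtain ⟨Zm, hZm, Z0, hZ0, Zp, hZp, hsum, hZpP, hZpim, hZmQ, hZmim, -, -, hZ0P, hZ0Q⟩ :=
      SymplecticTheta.exists_decomp 𝔊 hbr hT𝔊 hTT hP hQ hPmem hQmem hZ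
    obtain ⟨b, hb⟩ := hlineS Zp hZp hZpP hZpim
    obtain ⟨c, hc⟩ := hlineC Zm hZm hZmQ hZmim
    obtain ⟨y, hy𝔊, hyB, hyC⟩ := SymplecticThetaSix.skeleton_levi 𝔊 hbr hP hQ hPmem hQmem hPne hB₀𝔊 hB₀P
      hB₀im hC₁𝔊 hC₁Q hC₁im hBC hCB hlineS hlineC hZ0 hZ0P hZ0Q
    obtain ⟨x, u, v, hxuv⟩ := hspan𝔰 _ hy𝔊 hyB hyC
    refine ⟨c, y, b, x, u, v, ?_⟩
    rw [hsum, hc, hb, show Z0 = y • T + (Z0 - y • T) by abel, hxuv]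
    abel
  -- independence of `E′, F′` and of `T, B₀`
  have hliEF : LinearIndependent ℂ ![E', F'] := by
    rw [LinearIndependent.pair_iff]
    intro a b hab
    have h1 := congrArg (fun X : Module.End ℂ M => X pz) hab
    simp only [LinearMap.add_apply, LinearMap.smul_apply, LinearMap.zero_apply, hEpz, hFpz, smul_smul] at h1
    have h2 := congrArg (fun x => S x) h1
    simp only [map_add, map_smul, hSpu, hSpd, map_zero, smul_smul] at h2
    have ha : a = 0 := by
      have e1 : (2 * e * a) • pu = 0 := by
        have e2 : (2 * e * a) • pu = e • (a • pu + (b * -(τ * σ⁻¹)) • pd) +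
            ((a * e) • pu + (b * -(τ * σ⁻¹) * -e) • pd) := by module
        rw [e2, h1, h2, smul_zero, zero_add]
      have h3 := (smul_eq_zero.1 e1).resolve_right hpu0
      exact (mul_eq_zero.1 h3).resolve_left (mul_ne_zero two_ne_zero he)
    rw [ha, zero_smul, zero_add] at h1
    have hb : b = 0 := by
      have h3 := (smul_eq_zero.1 h1).resolve_right hpd0
      have h4 : τ * σ⁻¹ ≠ 0 := mul_ne_zero hτ (inv_ne_zero hσ)
      exact (mul_eq_zero.1 h3).resolve_right (neg_ne_zero.2 h4)
    exact ⟨ha, hb⟩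
  have hliTB : LinearIndependent ℂ ![T, B₀] := by
    rw [LinearIndependent.pair_iff]
    intro a b hab
    have h1 := congrArg (fun X : Module.End ℂ M => X pu) hab
    simp only [LinearMap.add_apply, LinearMap.smul_apply, LinearMap.zero_apply, hP pu hpuP, hB₀P pu hpuP,
      smul_zero, add_zero] at h1
    have ha : a = 0 := (smul_eq_zero.1 h1).resolve_right hpu0
    rw [ha, zero_smul, zero_add] at hab
    have h2 := congrArg (fun X : Module.End ℂ M => X (C₁ pu)) hab
    simp only [LinearMap.smul_apply, LinearMap.zero_apply, hBC pu hpuP] at h2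
    exact ⟨ha, (smul_eq_zero.1 h2).resolve_right hpu0⟩
  -- PART 3b and PART 3b′
  obtain ⟨κSS, κSE, κSF, κBC, κCB, κTB, κBB, κTC, κCC, κSC₁, κST, κSB₀, κEC₁, κET, κEB₀, κFC₁, κFT, κFB₀⟩ :=
    SymplecticThetaSix.skeleton_killing 𝔊 had hC₁𝔊 hT𝔊 hB₀𝔊 hS𝔊 hE'𝔊 hF'𝔊 hspan hliEF hliTB hC₁T hC₁B₀ hTB₀
      hSC hST hSB hEC hET hEB hFC hFT hFB he hSE hSF hEF
  obtain ⟨βSS, βSE, βSF, βBC, βCB, βTB, βBB, βTC, βCC, βmixed⟩ :=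
    SymplecticThetaSix.skeleton_traceForm hP hQ hPmem hQmem hP3 hB₀P hB₀im hC₁Q hC₁im hBC hCB hT.symm hEC hFC
      he hSE hSF hEF hpuP hpzP hpdP hpu0 hpz0 hpd0 hSpu hSpz hSpd hrr hEpz hEpd hFpu hFpz hFpd
  obtain ⟨βSC₁, βST, βSB₀⟩ := βmixed S hSC hSB
  obtain ⟨βEC₁, βET, βEB₀⟩ := βmixed E' hEC hEB
  obtain ⟨βFC₁, βFT, βFB₀⟩ := βmixed F' hFC hFB
  -- linearity of `ad`
  have had_lin : ∀ (c y b x u v : ℂ) (Z : Module.End ℂ M) (hZ : Z ∈ 𝔊),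
      Z = c • C₁ + y • T + b • B₀ + x • S + u • E' + v • F' →
      ad Z hZ = c • ad C₁ hC₁𝔊 + y • ad T hT𝔊 + b • ad B₀ hB₀𝔊 + x • ad S hS𝔊 + u • ad E' hE'𝔊 + v • ad F' hF'𝔊 := by
    intro c y b x u v Z hZ hZeq
    apply LinearMap.ext
    intro w
    apply Subtype.ext
    simp only [LinearMap.add_apply, LinearMap.smul_apply, Submodule.coe_add, Submodule.coe_smul]
    change Z * w - w * Z = c • (C₁ * w - w * C₁) + y • (T * w - w * T) + b • (B₀ * w - w * B₀) +
      x • (S * w - w * S) + u • (E' * w - w * E') + v • (F' * w - w * F')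
    rw [hZeq]
    simp only [add_mul, mul_add, smul_mul_assoc, mul_smul_comm, smul_sub]
    abel
  refine ⟨S, hS𝔊, fun h => hpu0 ?_, hST, fun Z hZ => ?_, fun X hX hrad => ?_⟩
  · -- `S ≠ 0`
    have h1 : S pu = 0 := by rw [h, LinearMap.zero_apply]
    rw [hSpu] at h1
    exact (smul_eq_zero.1 h1).resolve_left he
  · -- (i) `S` is in the radical
    obtain ⟨c, y, b, x, u, v, hZeq⟩ := hspan Z hZ
    rw [had_lin c y b x u v Z hZ hZeq]
    rw [hZeq]
    simp only [mul_add, mul_smul_comm, map_add, map_smul, LinearMap.comp_add, LinearMap.comp_smul, smul_eq_mul]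
    rw [βSC₁, βST, βSB₀, βSS, βSE, βSF, κSC₁, κST, κSB₀, κSS, κSE, κSF]
    ring
  · -- (ii) the radical is inside the centraliser of `T`
    obtain ⟨c, y, b, x, u, v, hXeq⟩ := hspan X hX
    have hXlin := had_lin c y b x u v X hX hXeq
    have hB := hrad B₀ hB₀𝔊
    have hC := hrad C₁ hC₁𝔊
    rw [hXlin] at hB hC
    rw [hXeq] at hB hC
    simp only [add_mul, smul_mul_assoc, map_add, map_smul, LinearMap.add_comp, LinearMap.smul_comp,
      smul_eq_mul] at hB hC
    rw [βCB, βTB, βBB, βSB₀, βEB₀, βFB₀, κCB, κTB, κBB, κSB₀, κEB₀, κFB₀] at hB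
    rw [βCC, βTC, βBC, βSC₁, βEC₁, βFC₁, κCC, κTC, κBC, κSC₁, κEC₁, κFC₁] at hC
    have hc : c = 0 := by linear_combination hB / (-5)
    have hb : b = 0 := by linear_combination hC / (-5)
    rw [hXeq, hc, hb, zero_smul, zero_smul, zero_add, add_zero, add_mul, add_mul, add_mul, mul_add, mul_add,
      mul_add, smul_mul_assoc, smul_mul_assoc, smul_mul_assoc, smul_mul_assoc, mul_smul_comm, mul_smul_comm,
      mul_smul_comm, mul_smul_comm, hST, hET, hFT]

end Radical


variable {V : Type u} [AddCommGroup V] [Module ℚ V] {n : ℤ}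

/-! ## §1 The Killing form commutes with base change -/

/-- **The Killing part of `Ψ` is rational on `𝔤 × 𝔤`.** For a bracket-closed `ℚ`-subspace `𝔤 ⊆ End_ℚ(V)` and
`X, Y ∈ 𝔤`, the trace on `𝔤_ℂ = spanC 𝔤` of `ad X_ℂ ∘ ad Y_ℂ` (`ad Z = (L_Z − R_Z)|_{𝔤_ℂ}`) is a rational number
(a `ℚ`-basis of `𝔤` is a `ℂ`-basis of `𝔤_ℂ` in which `ad X_ℂ ∘ ad Y_ℂ` has rational entries).
[cite: Humphreys1972, §5.1 (Killing form)]; [cite: Deligne1982HodgeCycles, I §3 (proof of Prop. 3.4: rational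
structures and base change)] -/
theorem SymplecticThetaSix.killing_baseChange_rational [Module.Finite ℚ V] (𝔤 : Submodule ℚ (Module.End ℚ V))
    (hbr : ∀ X ∈ 𝔤, ∀ X' ∈ 𝔤, X * X' - X' * X ∈ 𝔤)
    (had : ∀ X ∈ spanC 𝔤, ∀ Z ∈ spanC 𝔤, (LinearMap.mulLeft ℂ X - LinearMap.mulRight ℂ X) Z ∈ spanC 𝔤)
    {X Y : Module.End ℚ V} (hX : X ∈ 𝔤) (hY : Y ∈ 𝔤) :
    ∃ q : ℚ, LinearMap.trace ℂ ↥(spanC 𝔤)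
      (((LinearMap.mulLeft ℂ (X.baseChange ℂ) - LinearMap.mulRight ℂ (X.baseChange ℂ)).restrict
          (had _ (baseChange_mem_spanC hX))) ∘ₗ
        ((LinearMap.mulLeft ℂ (Y.baseChange ℂ) - LinearMap.mulRight ℂ (Y.baseChange ℂ)).restrict
          (had _ (baseChange_mem_spanC hY)))) = (q : ℂ) := by
  classical
  set f := ((LinearMap.mulLeft ℂ (X.baseChange ℂ) - LinearMap.mulRight ℂ (X.baseChange ℂ)).restrict
      (had _ (baseChange_mem_spanC hX))) ∘ₗ
    ((LinearMap.mulLeft ℂ (Y.baseChange ℂ) - LinearMap.mulRight ℂ (Y.baseChange ℂ)).restrict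
      (had _ (baseChange_mem_spanC hY))) with hf
  -- a `ℚ`-basis of `𝔤` and its complexification
  set n := Module.finrank ℚ ↥𝔤
  let b : Module.Basis (Fin n) ℚ ↥𝔤 := Module.finBasis ℚ ↥𝔤
  let E : Fin n → ↥(spanC 𝔤) := fun i => ⟨((b i : ↥𝔤) : Module.End ℚ V).baseChange ℂ, baseChange_mem_spanC (b i).2⟩
  have hbc : ∀ (d : Fin n → ℚ), (((∑ i, d i • b i : ↥𝔤) : Module.End ℚ V)).baseChange ℂ =
      ∑ i, ((d i : ℂ)) • (((b i : ↥𝔤) : Module.End ℚ V).baseChange ℂ) := by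
    intro d
    rw [Submodule.coe_sum, ← LinearMap.baseChangeHom_apply, map_sum]
    refine Finset.sum_congr rfl fun i _ => ?_
    rw [Submodule.coe_smul, map_smul, LinearMap.baseChangeHom_apply, Rat.cast_smul_eq_qsmul ℂ (d i)]
  have hbcE : ∀ W : ↥𝔤, (⟨(W : Module.End ℚ V).baseChange ℂ, baseChange_mem_spanC W.2⟩ : ↥(spanC 𝔤)) =
      ∑ i, ((b.repr W i : ℂ)) • E i := by
    intro W
    apply Subtype.ext
    have hW : (W : Module.End ℚ V) = ((∑ i, b.repr W i • b i : ↥𝔤) : Module.End ℚ V) := by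
      rw [b.sum_repr W]
    change (W : Module.End ℚ V).baseChange ℂ = _
    rw [hW, hbc, Submodule.coe_sum]
    refine Finset.sum_congr rfl fun i _ => ?_
    rw [Submodule.coe_smul]
  -- independence of the `E i` (flatness of `ℂ/ℚ`)
  have hli : LinearIndependent ℂ E := by
    set κ := LinearEquiv.ofBijective (homBaseChange V V) (homBaseChange_bijective (V := V) (W := V)) with hκ
    have hκapply : ∀ Z : Module.End ℚ V, κ ((1 : ℂ) ⊗ₜ[ℚ] Z) = Z.baseChange ℂ := fun Z => by
      rw [hκ, LinearEquiv.ofBijective_apply, homBaseChange_tmul, one_smul]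
    have hsub : Function.Injective (𝔤.subtype.baseChange ℂ) := by
      have h := Module.Flat.lTensor_preserves_injective_linearMap (M := ℂ) 𝔤.subtype 𝔤.injective_subtype
      intro a c hac
      exact h (by simpa [LinearMap.baseChange_eq_ltensor] using hac)
    have h0 : LinearIndependent ℂ fun i => (κ.toLinearMap ∘ₗ 𝔤.subtype.baseChange ℂ) ((b.baseChange ℂ) i) :=
      (b.baseChange ℂ).linearIndependent.map' (κ.toLinearMap ∘ₗ 𝔤.subtype.baseChange ℂ)
        (LinearMap.ker_eq_bot.2 (κ.injective.comp hsub))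
    have h1 : (fun i => (κ.toLinearMap ∘ₗ 𝔤.subtype.baseChange ℂ) ((b.baseChange ℂ) i)) =
        fun i => ((E i : ↥(spanC 𝔤)) : Module.End ℂ (ℂ ⊗[ℚ] V)) := by
      funext i
      simp only [LinearMap.coe_comp, Function.comp_apply, Module.Basis.baseChange_apply, LinearMap.baseChange_tmul,
        Submodule.coe_subtype, LinearEquiv.coe_toLinearMap, hκapply, E]
    rw [h1] at h0
    exact LinearIndependent.of_comp (spanC 𝔤).subtype h0
  -- spanning
  have hdef : spanC 𝔤 =
      Submodule.span ℂ ((fun Z : Module.End ℚ V => Z.baseChange ℂ) '' (𝔤 : Set (Module.End ℚ V))) := rfl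
  have hsp : ⊤ ≤ Submodule.span ℂ (Set.range E) := by
    rintro W -
    have hW : (W : Module.End ℂ (ℂ ⊗[ℚ] V)) ∈
        Submodule.span ℂ (Set.range fun i => ((b i : ↥𝔤) : Module.End ℚ V).baseChange ℂ) := by
      have hle : spanC 𝔤 ≤ Submodule.span ℂ (Set.range fun i => ((b i : ↥𝔤) : Module.End ℚ V).baseChange ℂ) := by
        rw [hdef, Submodule.span_le]
        rintro _ ⟨Z, hZ, rfl⟩
        have h := congrArg Subtype.val (hbcE ⟨Z, hZ⟩)
        simp only [Submodule.coe_sum, Submodule.coe_smul] at h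
        change Z.baseChange ℂ ∈ _
        rw [h]
        exact Submodule.sum_mem _ fun i _ => Submodule.smul_mem _ _ (Submodule.subset_span ⟨i, rfl⟩)
      exact hle W.2
    obtain ⟨c, hc⟩ := (Submodule.mem_span_range_iff_exists_fun ℂ).1 hW
    have hWc : W = ∑ i, c i • E i := by
      apply Subtype.ext
      rw [← hc, Submodule.coe_sum]
      refine Finset.sum_congr rfl fun i _ => ?_
      rw [Submodule.coe_smul]
    rw [hWc]
    exact Submodule.sum_mem _ fun i _ => Submodule.smul_mem _ _ (Submodule.subset_span ⟨i, rfl⟩)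
  let bE : Module.Basis (Fin n) ℂ ↥(spanC 𝔤) := Module.Basis.mk hli hsp
  have hbE : ∀ i, bE i = E i := fun i => Module.Basis.mk_apply hli hsp i
  -- `f (E i)` is the complexification of the rational double bracket
  have hWmem : ∀ i, X * (Y * (b i : Module.End ℚ V) - (b i : Module.End ℚ V) * Y) -
      (Y * (b i : Module.End ℚ V) - (b i : Module.End ℚ V) * Y) * X ∈ 𝔤 :=
    fun i => hbr X hX _ (hbr Y hY _ (b i).2)
  have hfE : ∀ i, f (E i) = ⟨(X * (Y * (b i : Module.End ℚ V) - (b i : Module.End ℚ V) * Y) -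
      (Y * (b i : Module.End ℚ V) - (b i : Module.End ℚ V) * Y) * X).baseChange ℂ,
      baseChange_mem_spanC (hWmem i)⟩ := by
    intro i
    apply Subtype.ext
    simp only [hf, LinearMap.coe_comp, Function.comp_apply, LinearMap.restrict_apply, LinearMap.sub_apply,
      LinearMap.mulLeft_apply, LinearMap.mulRight_apply, E, LinearMap.baseChange_sub, LinearMap.baseChange_mul]
  have hfE' : ∀ i, f (bE i) = ∑ l, ((b.repr ⟨_, hWmem i⟩ l : ℂ)) • bE l := by
    intro i
    rw [hbE, hfE, hbcE ⟨_, hWmem i⟩]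
    refine Finset.sum_congr rfl fun l _ => ?_
    rw [hbE]
  -- the trace is the sum of the rational diagonal entries
  refine ⟨∑ i, b.repr ⟨_, hWmem i⟩ i, ?_⟩
  rw [LinearMap.trace_eq_matrix_trace ℂ bE f, Matrix.trace]
  push_cast
  refine Finset.sum_congr rfl fun i _ => ?_
  rw [Matrix.diag_apply, LinearMap.toMatrix_apply, hfE', bE.repr_sum_self]

/-! ## §2 The dimension count and the main theorem -/

/-- `dim V^{1,0} = dim V^{0,1} = 3` for an effective weight-one Hodge structure of rank six.
[cite: MoonenZarhin1999LowDim, §2 (2.3)] -/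
theorem SymplecticThetaSix.finrank_pieces_eq_three [Module.Finite ℚ V] (H : HodgeStructure V n) (hn : n = 1)
    (heff : H.IsEffective) (hV : Module.finrank ℚ V = 6) {Θ : Module.End ℂ (ℂ ⊗[ℚ] V)}
    (hΘ : ∀ p, ∀ x ∈ H.piece p (n - p), Θ x = ((2 * p - n : ℤ) : ℂ) • x) :
    Module.finrank ℂ (H.piece 1 0) = 3 ∧ Module.finrank ℂ (H.piece 0 1) = 3 := by
  subst hn
  obtain ⟨hP, hQ, hΘ10, hΘ01, -⟩ := UnitaryTheta.theta_facts H rfl heff hΘ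
  have hPQ : ∀ v, (2 : ℂ)⁻¹ • (v + Θ v) + (2 : ℂ)⁻¹ • (v - Θ v) = v := fun v => by module
  have hsup : H.piece 1 0 ⊔ H.piece 0 1 = ⊤ := by
    rw [eq_top_iff]
    intro v _
    rw [← hPQ v]
    exact Submodule.add_mem_sup (hP v) (hQ v)
  have hinf : H.piece 1 0 ⊓ H.piece 0 1 = ⊥ := by
    rw [eq_bot_iff]
    intro x hx
    rw [Submodule.mem_bot]
    have h1 := hΘ10 x hx.1
    rw [hΘ01 x hx.2, neg_eq_iff_add_eq_zero, ← two_smul ℂ x, smul_eq_zero] at h1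
    exact h1.resolve_left (two_ne_zero' ℂ)
  have hsum := Submodule.finrank_sup_add_finrank_inf_eq (H.piece 1 0) (H.piece 0 1)
  rw [hsup, hinf, finrank_top, finrank_bot, add_zero, Module.finrank_baseChange, hV] at hsum
  have hsymm : Module.finrank ℂ (H.piece 1 0) = Module.finrank ℂ (H.piece 0 1) := hodgeNumber_symm_holds H 1 0
  omega

/-- **Theorem (`𝔤_ℂ = 𝔰𝔭(V, ψ)_ℂ` for a generic weight-one Hodge structure of rank six; the Lie step of
Moonen–Zarhin 1999 (2.3) Type I(1), `g = 3`, for an arbitrary admissible rational Lie algebra).** Let `H` be an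
effective polarized `ℚ`-Hodge structure of weight `1` with `dim V = 6` and `End_Hdg(V) = ℚ`, `𝔤 ⊆ End_ℚ(V)` a
bracket-closed `ℚ`-subspace of `ψ`-skew operators whose complex span contains a Hodge operator `Θ`. Then every
`ψ_ℂ`-skew operator `Y` of `V_ℂ` lies in `𝔤_ℂ`. (MZ99 (2.3): «Type 1(1): `X` is an abelian 3-fold with
`End⁰(X) = ℚ`. Then `Hg(X) = Sp(V,φ) ≅ Sp_{6,ℚ}`»; the E³-type alternative (2.5) is excluded here for EVERY
admissible `𝔤`, by the rational invariant `tr − 2κ`.) [cite: MoonenZarhin1999LowDim, §2 (2.3), (2.5)];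
[cite: Deligne1982HodgeCycles, I §3 Prop. 3.4] -/
theorem SymplecticThetaSix.mem_spanC_of_skew [Module.Finite ℚ V] (H : HodgeStructure V n) (hn : n = 1)
    (heff : H.IsEffective) (ψ : H.Polarization) (hE : ∀ a ∈ H.endAlg, ∃ x : ℚ, a = x • 1)
    (hV : Module.finrank ℚ V = 6) (𝔤 : Submodule ℚ (Module.End ℚ V))
    (hbr : ∀ X ∈ 𝔤, ∀ X' ∈ 𝔤, X * X' - X' * X ∈ 𝔤) {Θ : Module.End ℂ (ℂ ⊗[ℚ] V)}
    (hΘ : ∀ p, ∀ x ∈ H.piece p (n - p), Θ x = ((2 * p - n : ℤ) : ℂ) • x) (hΘ𝔤 : Θ ∈ spanC 𝔤)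
    (hskew : ∀ X ∈ 𝔤, ∀ v w, ψ.form (X v) w + ψ.form v (X w) = 0) {Y : Module.End ℂ (ℂ ⊗[ℚ] V)}
    (hYskew : ∀ x y, ψ.form.baseChange ℂ (Y x) y + ψ.form.baseChange ℂ x (Y y) = 0) : Y ∈ spanC 𝔤 := by
  classical
  have hfin := SymplecticThetaSix.finrank_pieces_eq_three H hn heff hV hΘ
  have hirr : ∀ U : Submodule ℂ (ℂ ⊗[ℚ] V), (∀ Z ∈ spanC 𝔤, ∀ u ∈ U, Z u ∈ U) → U = ⊥ ∨ U = ⊤ :=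
    fun U hU => SymplecticTheta.eq_bot_or_top_of_stable H hn heff ψ hE 𝔤 hΘ hΘ𝔤 hskew
      fun X hX u hu => hU _ (baseChange_mem_spanC hX) u hu
  subst hn
  obtain ⟨hP, hQ, hΘ10, hΘ01, hΘΘ⟩ := UnitaryTheta.theta_facts H rfl heff hΘ
  set ω := ψ.form.baseChange ℂ with hω
  have hωnd : ω.Nondegenerate := ψ.nondegenerate_baseChange
  have hωalt : ∀ x y, ω x y = -ω y x := fun x y => by
    rw [hω, ψ.form_baseChange_swap y x, Int.negOnePow_odd 1 odd_one]
    norm_num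
  -- the complex Lie algebra `𝔊 = 𝔤_ℂ`
  have h𝔊br : ∀ Z ∈ spanC 𝔤, ∀ Z' ∈ spanC 𝔤, Z * Z' - Z' * Z ∈ spanC 𝔤 := fun Z hZ Z' hZ' =>
    commutator_mem_spanC hbr hZ hZ'
  have had : ∀ Z ∈ spanC 𝔤, ∀ Z' ∈ spanC 𝔤, (LinearMap.mulLeft ℂ Z - LinearMap.mulRight ℂ Z) Z' ∈ spanC 𝔤 :=
    fun Z hZ Z' hZ' => by simpa using h𝔊br Z hZ Z' hZ'
  have h𝔊skew : ∀ Z ∈ spanC 𝔤, ∀ x y, ω (Z x) y + ω x (Z y) = 0 := fun Z hZ =>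
    ThetaSubalgebra.formBaseChange_add_eq_zero_of_mem_spanC ψ hskew hZ
  -- the dichotomy for `T = Θ`
  rcases SymplecticThetaSix.core_dichotomy ω hωnd hωalt (spanC 𝔤) h𝔊br h𝔊skew hΘ𝔤 hΘΘ
    (P := H.piece 1 0) (Q := H.piece 0 1) hΘ10 hΘ01 hP hQ hirr hfin.1 with ⟨hA, hB, hC⟩ | hbad
  · -- GOOD: `𝔲⁺ ⊕ 𝔤𝔩(P) ⊕ 𝔲⁻ ⊆ 𝔤_ℂ`; decompose `Y` along `ad Θ` inside the `ψ_ℂ`-skew operators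
    let 𝔰 : Submodule ℂ (Module.End ℂ (ℂ ⊗[ℚ] V)) :=
      { carrier := {Z | ∀ x y, ω (Z x) y + ω x (Z y) = 0}
        zero_mem' := fun x y => by simp
        add_mem' := by
          intro Z Z' hZ hZ' x y
          simp only [LinearMap.add_apply, map_add]
          have h1 := hZ x y
          have h2 := hZ' x y
          linear_combination h1 + h2
        smul_mem' := by
          intro c Z hZ x y
          simp only [LinearMap.smul_apply, map_smul, smul_eq_mul]
          have h1 := hZ x y
          linear_combination c * h1 }
    have hmem𝔰 : ∀ Z, Z ∈ 𝔰 ↔ ∀ x y, ω (Z x) y + ω x (Z y) = 0 := fun Z => Iff.rfl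
    have h𝔰br : ∀ Z ∈ 𝔰, ∀ Z' ∈ 𝔰, Z * Z' - Z' * Z ∈ 𝔰 := by
      intro Z hZ Z' hZ'
      rw [hmem𝔰] at hZ hZ' ⊢
      intro x y
      simp only [LinearMap.sub_apply, Module.End.mul_apply, map_sub]
      have h1 := hZ (Z' x) y
      have h2 := hZ x (Z' y)
      have h3 := hZ' (Z x) y
      have h4 := hZ' x (Z y)
      linear_combination h1 - h4 + h2 - h3
    have hΘ𝔰 : Θ ∈ 𝔰 := (hmem𝔰 Θ).2 (h𝔊skew Θ hΘ𝔤)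
    have hY𝔰 : Y ∈ 𝔰 := (hmem𝔰 Y).2 hYskew
    obtain ⟨Ym, hYm, Y0, hY0, Yp, hYp, hYeq, hYpP, hYpim, hYmQ, hYmim, -, -, hY0P, hY0Q⟩ :=
      SymplecticTheta.exists_decomp 𝔰 h𝔰br hΘ𝔰 hΘΘ (P := H.piece 1 0) (Q := H.piece 0 1) hΘ10 hΘ01 hP hQ hY𝔰
    rw [hYeq]
    refine Submodule.add_mem _ (Submodule.add_mem _ ?_ ?_) ?_
    · exact hC Ym ((hmem𝔰 Ym).1 hYm) hYmQ hYmim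
    · exact hB Y0 ((hmem𝔰 Y0).1 hY0) hY0P hY0Q
    · exact hA Yp ((hmem𝔰 Yp).1 hYp) hYpP hYpim
  · -- SKELETON: impossible by the rational invariant `tr − 2κ`
    exfalso
    obtain ⟨B₀, hB₀𝔊, C₁, hC₁𝔊, hB₀P, hB₀im, hC₁Q, hC₁im, hBC, hCB, hlineS, hlineC⟩ := hbad
    obtain ⟨S, hS𝔊, hS0, -, hSrad, hrad⟩ := SymplecticThetaSix.skeleton_radical ω hωnd hωalt (spanC 𝔤) h𝔊br
      had h𝔊skew hΘ𝔤 hΘΘ (P := H.piece 1 0) (Q := H.piece 0 1) hΘ10 hΘ01 hP hQ hirr hfin.1 hB₀𝔊 hB₀P hB₀im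
      hC₁𝔊 hC₁Q hC₁im hBC hCB hlineS hlineC
    -- the invariant form `Ψ` on `𝔤_ℂ`
    set 𝔊 := spanC 𝔤 with h𝔊def
    let ad : ↥𝔊 → (↥𝔊 →ₗ[ℂ] ↥𝔊) := fun X =>
      (LinearMap.mulLeft ℂ (X : Module.End ℂ (ℂ ⊗[ℚ] V)) - LinearMap.mulRight ℂ (X : Module.End ℂ (ℂ ⊗[ℚ] V))).restrict
        (had X.1 X.2)
    have had_coe : ∀ (X W : ↥𝔊), ((ad X W : ↥𝔊) : Module.End ℂ (ℂ ⊗[ℚ] V)) = X * W - W * X := fun X W => rfl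
    have had_add : ∀ X X' : ↥𝔊, ad (X + X') = ad X + ad X' := by
      intro X X'
      apply LinearMap.ext
      intro W
      apply Subtype.ext
      rw [LinearMap.add_apply, Submodule.coe_add, had_coe, had_coe, had_coe, Submodule.coe_add]
      noncomm_ring
    have had_smul : ∀ (c : ℂ) (X : ↥𝔊), ad (c • X) = c • ad X := by
      intro c X
      apply LinearMap.ext
      intro W
      apply Subtype.ext
      rw [LinearMap.smul_apply, Submodule.coe_smul, had_coe, had_coe, Submodule.coe_smul, smul_sub, smul_mul_assoc,
        mul_smul_comm]
    let Ψ : ↥𝔊 →ₗ[ℂ] ↥𝔊 →ₗ[ℂ] ℂ := LinearMap.mk₂ ℂ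
      (fun X Z => LinearMap.trace ℂ (ℂ ⊗[ℚ] V) ((X : Module.End ℂ (ℂ ⊗[ℚ] V)) * Z) -
        2 * LinearMap.trace ℂ ↥𝔊 (ad X ∘ₗ ad Z))
      (by
        intro X X' Z
        simp only [Submodule.coe_add, add_mul, map_add, had_add, LinearMap.add_comp]
        ring)
      (by
        intro c X Z
        simp only [Submodule.coe_smul, smul_mul_assoc, map_smul, had_smul, LinearMap.smul_comp, smul_eq_mul]
        ring)
      (by
        intro X Z Z'
        simp only [Submodule.coe_add, mul_add, map_add, had_add, LinearMap.comp_add]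
        ring)
      (by
        intro c X Z
        simp only [Submodule.coe_smul, mul_smul_comm, map_smul, had_smul, LinearMap.comp_smul, smul_eq_mul]
        ring)
    have hΨ : ∀ X Z : ↥𝔊, Ψ X Z = LinearMap.trace ℂ (ℂ ⊗[ℚ] V) ((X : Module.End ℂ (ℂ ⊗[ℚ] V)) * Z) -
        2 * LinearMap.trace ℂ ↥𝔊 (ad X ∘ₗ ad Z) := fun X Z => rfl
    -- `Ψ` is rational on `𝔤 × 𝔤`
    have hrat : ∀ (X : Module.End ℚ V) (hX : X ∈ 𝔤) (X' : Module.End ℚ V) (hX' : X' ∈ 𝔤), ∃ q : ℚ,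
        Ψ ⟨X.baseChange ℂ, baseChange_mem_spanC hX⟩ ⟨X'.baseChange ℂ, baseChange_mem_spanC hX'⟩ = (q : ℂ) := by
      intro X hX X' hX'
      obtain ⟨q, hq⟩ := SymplecticThetaSix.killing_baseChange_rational 𝔤 hbr had hX hX'
      refine ⟨LinearMap.trace ℚ V (X * X') - 2 * q, ?_⟩
      rw [hΨ]
      change LinearMap.trace ℂ (ℂ ⊗[ℚ] V) (X.baseChange ℂ * X'.baseChange ℂ) - 2 * LinearMap.trace ℂ ↥𝔊
        (((LinearMap.mulLeft ℂ (X.baseChange ℂ) - LinearMap.mulRight ℂ (X.baseChange ℂ)).restrict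
          (had _ (baseChange_mem_spanC hX))) ∘ₗ
        ((LinearMap.mulLeft ℂ (X'.baseChange ℂ) - LinearMap.mulRight ℂ (X'.baseChange ℂ)).restrict
          (had _ (baseChange_mem_spanC hX')))) = _
      rw [hq, ← LinearMap.baseChange_mul, LinearMap.trace_baseChange]
      push_cast
      rfl
    -- `S` is a nonzero radical vector of `Ψ`
    have hZ0 : (⟨S, hS𝔊⟩ : ↥𝔊) ≠ 0 := fun h => hS0 (congrArg Subtype.val h)
    have hSrad' : ∀ (X' : Module.End ℚ V) (hX' : X' ∈ 𝔤),
        Ψ ⟨S, hS𝔊⟩ ⟨X'.baseChange ℂ, baseChange_mem_spanC hX'⟩ = 0 := by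
      intro X' hX'
      rw [hΨ, hSrad _ (baseChange_mem_spanC hX'), sub_self]
    obtain ⟨X, hX𝔤, hX0, hXrad⟩ := spanC_exists_rational_radical 𝔤 Ψ hrat hZ0 hSrad'
    -- hence `X_ℂ` commutes with `Θ`
    have hXΘ : X.baseChange ℂ * Θ = Θ * X.baseChange ℂ := by
      refine hrad (X.baseChange ℂ) (baseChange_mem_spanC hX𝔤) fun Z hZ => ?_
      have h := hXrad ⟨Z, hZ⟩
      rw [hΨ] at h
      exact sub_eq_zero.1 h
    -- so `X` is a Hodge endomorphism, hence a scalar, hence `0`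
    have hXend : X ∈ H.endAlg := by
      refine ImaginaryQuadraticRankFour.mem_endAlg_of_mapsTo_piece H rfl heff fun x hx => ?_
      have h1 : Θ (X.baseChange ℂ x) = X.baseChange ℂ x := by
        rw [← Module.End.mul_apply, ← hXΘ, Module.End.mul_apply, hΘ10 x hx]
      have h2 := hP (X.baseChange ℂ x)
      rwa [h1, ← two_smul ℂ (X.baseChange ℂ x), smul_smul, inv_mul_cancel₀ (two_ne_zero' ℂ), one_smul] at h2
    obtain ⟨x, hx⟩ := hE X hXend
    have hx0 : x = 0 := by
      by_contra hx0
      have hψ0 : ∀ v w, ψ.form v w = 0 := fun v w => by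
        have h := hskew X hX𝔤 v w
        simp only [hx, LinearMap.smul_apply, Module.End.one_apply, map_smul, smul_eq_mul] at h
        have h2 : (2 * x) * ψ.form v w = 0 := by linear_combination h
        exact (mul_eq_zero.1 h2).resolve_left (mul_ne_zero two_ne_zero hx0)
      have hV0 : Module.finrank ℚ V = 0 := by
        rw [finrank_zero_iff_forall_zero]
        intro v
        exact ψ.nondegenerate.1 v fun w => hψ0 v w
      omega
    exact hX0 (by rw [hx, hx0, zero_smul])

/-- **`𝔤_ℂ = 𝔰𝔭(V, ψ)_ℂ` as an equivalence** (rank six). [cite: MoonenZarhin1999LowDim, §2 (2.3)] -/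
theorem SymplecticThetaSix.mem_spanC_iff_skew [Module.Finite ℚ V] (H : HodgeStructure V n) (hn : n = 1)
    (heff : H.IsEffective) (ψ : H.Polarization) (hE : ∀ a ∈ H.endAlg, ∃ x : ℚ, a = x • 1)
    (hV : Module.finrank ℚ V = 6) (𝔤 : Submodule ℚ (Module.End ℚ V))
    (hbr : ∀ X ∈ 𝔤, ∀ X' ∈ 𝔤, X * X' - X' * X ∈ 𝔤) {Θ : Module.End ℂ (ℂ ⊗[ℚ] V)}
    (hΘ : ∀ p, ∀ x ∈ H.piece p (n - p), Θ x = ((2 * p - n : ℤ) : ℂ) • x) (hΘ𝔤 : Θ ∈ spanC 𝔤)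
    (hskew : ∀ X ∈ 𝔤, ∀ v w, ψ.form (X v) w + ψ.form v (X w) = 0) (Y : Module.End ℂ (ℂ ⊗[ℚ] V)) :
    Y ∈ spanC 𝔤 ↔ ∀ x y, ψ.form.baseChange ℂ (Y x) y + ψ.form.baseChange ℂ x (Y y) = 0 :=
  ⟨fun hY => ThetaSubalgebra.formBaseChange_add_eq_zero_of_mem_spanC ψ hskew hY,
    fun hY => SymplecticThetaSix.mem_spanC_of_skew H hn heff ψ hE hV 𝔤 hbr hΘ hΘ𝔤 hskew hY⟩

/-- **`𝔤 = 𝔰𝔭(V, ψ)` over `ℚ`** (rank six; descent `X ∈ 𝔤 ↔ X_ℂ ∈ 𝔤_ℂ`).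
[cite: MoonenZarhin1999LowDim, §2 (2.3)]; [cite: Deligne1982HodgeCycles, I §3 (proof of Prop. 3.4)] -/
theorem SymplecticThetaSix.mem_iff_skew [Module.Finite ℚ V] (H : HodgeStructure V n) (hn : n = 1)
    (heff : H.IsEffective) (ψ : H.Polarization) (hE : ∀ a ∈ H.endAlg, ∃ x : ℚ, a = x • 1)
    (hV : Module.finrank ℚ V = 6) (𝔤 : Submodule ℚ (Module.End ℚ V))
    (hbr : ∀ X ∈ 𝔤, ∀ X' ∈ 𝔤, X * X' - X' * X ∈ 𝔤) {Θ : Module.End ℂ (ℂ ⊗[ℚ] V)}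
    (hΘ : ∀ p, ∀ x ∈ H.piece p (n - p), Θ x = ((2 * p - n : ℤ) : ℂ) • x) (hΘ𝔤 : Θ ∈ spanC 𝔤)
    (hskew : ∀ X ∈ 𝔤, ∀ v w, ψ.form (X v) w + ψ.form v (X w) = 0) (X : Module.End ℚ V) :
    X ∈ 𝔤 ↔ ∀ v w, ψ.form (X v) w + ψ.form v (X w) = 0 := by
  refine ⟨hskew X, fun hX => ?_⟩
  exact mem_of_baseChange_mem_spanC 𝔤 (SymplecticThetaSix.mem_spanC_of_skew H hn heff ψ hE hV 𝔤 hbr hΘ hΘ𝔤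
    hskew (ThetaSubalgebra.formBaseChange_add_eq_zero_of_skew ψ hX))

/-- **`Lie Hg(H) = 𝔰𝔭(V, ψ)` (Moonen–Zarhin 1999 (2.3), Type I(1), `g = 3`: "`Hg(X) = Sp(V,φ) ≅ Sp_{6,ℚ}`",
infinitesimally):** for an effective polarized weight-one `H` with `dim V = 6` and `End_Hdg(V) = ℚ`, a rational
operator lies in the Lie algebra of the Hodge group iff it is `ψ`-skew. `Lie Hg(H)` is admissible:
bracket-closed (`commutator_mem_hodgeLie`), `Θ ∈ Lie Hg ⊗ ℂ` (`mem_hodgeLieC_of_forall_piece`), `ψ`-skew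
(`form_apply_add_eq_zero_of_mem_hodgeLie`). [cite: MoonenZarhin1999LowDim, §2 (2.3) and (1.8)]
[cite: Huybrechts2016K3, Thm. 3.3.9 (proof, p. 67)] -/
theorem SymplecticThetaSix.mem_hodgeLie_iff_skew [Module.Finite ℚ V] [HodgeTensorFacts.{u, u}] (H : HodgeStructure V n)
    (hn : n = 1) (heff : H.IsEffective) (ψ : H.Polarization) (hE : ∀ a ∈ H.endAlg, ∃ x : ℚ, a = x • 1)
    (hV : Module.finrank ℚ V = 6) (X : Module.End ℚ V) :
    X ∈ H.hodgeLie ↔ ∀ v w, ψ.form (X v) w + ψ.form v (X w) = 0 := by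
  obtain ⟨Θ, hΘ⟩ := exists_hodgeTheta H
  have hΘ𝔤 : Θ ∈ spanC H.hodgeLie := (hodgeLieC_eq_spanC H) ▸ H.mem_hodgeLieC_of_forall_piece hΘ
  exact SymplecticThetaSix.mem_iff_skew H hn heff ψ hE hV H.hodgeLie (fun X hX Y hY => H.commutator_mem_hodgeLie hX hY)
    hΘ hΘ𝔤 (fun X hX => form_apply_add_eq_zero_of_mem_hodgeLie ψ hX) X

/-- **`𝔤 = Lie Hg(H)`: `Lie Hg(H)` is the only rational Lie subalgebra of `𝔰𝔭(V, ψ)` whose complexification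
contains `Θ`** (Deligne's minimality, LNM 900 I Prop. 3.4, in Lie form, for the generic rank-six case).
[cite: Deligne1982HodgeCycles, I §3 Prop. 3.4] [cite: MoonenZarhin1999LowDim, §2 (2.3)] -/
theorem SymplecticThetaSix.eq_hodgeLie [Module.Finite ℚ V] [HodgeTensorFacts.{u, u}] (H : HodgeStructure V n)
    (hn : n = 1) (heff : H.IsEffective) (ψ : H.Polarization) (hE : ∀ a ∈ H.endAlg, ∃ x : ℚ, a = x • 1)
    (hV : Module.finrank ℚ V = 6) (𝔤 : Submodule ℚ (Module.End ℚ V))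
    (hbr : ∀ X ∈ 𝔤, ∀ X' ∈ 𝔤, X * X' - X' * X ∈ 𝔤) {Θ : Module.End ℂ (ℂ ⊗[ℚ] V)}
    (hΘ : ∀ p, ∀ x ∈ H.piece p (n - p), Θ x = ((2 * p - n : ℤ) : ℂ) • x) (hΘ𝔤 : Θ ∈ spanC 𝔤)
    (hskew : ∀ X ∈ 𝔤, ∀ v w, ψ.form (X v) w + ψ.form v (X w) = 0) : 𝔤 = H.hodgeLie := by
  ext X
  rw [SymplecticThetaSix.mem_iff_skew H hn heff ψ hE hV 𝔤 hbr hΘ hΘ𝔤 hskew,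
    SymplecticThetaSix.mem_hodgeLie_iff_skew H hn heff ψ hE hV]

/-! ## §3 Theorem L-Sp in rank six: rational tensors killed by `Θ` are killed by `𝔰𝔭(V_ℂ, ψ_ℂ)` -/

section AnnLie

open Literature.RepresentationTheory.GeneralLinear Literature.NumberTheory.DiophantineGeometry

variable {M N k : ℕ}

/-- **Theorem L-Sp (invariance of rational tensors under `𝔰𝔭(V_ℂ, ψ_ℂ)`; the Lie step of `B(Xⁿ) = D(Xⁿ)` for a
generic abelian THREEFOLD).** In the setting of `SymplecticThetaSix.mem_spanC_of_skew`, let `q` be a rational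
coefficient tensor (letters: slots `Fin k` × a `ℚ`-basis `eQ` of `V`) killed — slice by slice, diagonally — by
the matrix of the Hodge operator `Θ`. Then `q` is killed by the matrix of EVERY `ψ_ℂ`-skew operator `Y` of
`V_ℂ`. Proof: the rational Lie algebra `𝔞 ⊆ 𝔰𝔭(V, ψ)` of operators killing `q` (`annLie`, with `End_Hdg(V)` as
commuting family) is bracket-closed and `Θ ∈ 𝔞_ℂ` by descent (`mem_spanC_annLie`, Deligne LNM 900 I §3), so
`𝔞_ℂ = 𝔰𝔭(V_ℂ, ψ_ℂ) ∋ Y` by the theorem, and `𝔞_ℂ` kills `q_ℂ`. (MZ99 p. 715: "`Hg(X) = Sp_D(V,φ)` […] it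
follows that `B(Xⁿ) = D(Xⁿ)` for all `n`"; the passage to divisor classes is by the invariant theory of `Sp`,
Milne 1999 Prop. 3.6 (a).) [cite: MoonenZarhin1999LowDim, §2 p. 715 and (2.3), §1 (1.8)]
[cite: Deligne1982HodgeCycles, I §3 (proof of Prop. 3.4)] [cite: Milne1999LefschetzClasses, Prop. 3.6 (a)] -/
theorem SymplecticThetaSix.wordDerAt_eq_zero_of_skew [Module.Finite ℚ V] [HodgeTensorFacts.{u, u}]
    (H : HodgeStructure V n) (hn : n = 1) (heff : H.IsEffective) (ψ : H.Polarization)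
    (hE : ∀ a ∈ H.endAlg, ∃ x : ℚ, a = x • 1) (hV : Module.finrank ℚ V = 6)
    (eQ : Module.Basis (Fin M) ℚ V) (q : (Fin N → Fin k × Fin M) → ℚ) {Θ : Module.End ℂ (ℂ ⊗[ℚ] V)}
    (hΘ : ∀ p, ∀ x ∈ H.piece p (n - p), Θ x = ((2 * p - n : ℤ) : ℂ) • x)
    (hΘq : ∀ u : Fin N → Fin k, wordDerAt ℂ (fun _ : Fin N =>
      LinearMap.toMatrix (Algebra.TensorProduct.basis ℂ eQ) (Algebra.TensorProduct.basis ℂ eQ) Θ)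
      (wordSlice (fun w => algebraMap ℚ ℂ (q w)) u) = 0)
    {Y : Module.End ℂ (ℂ ⊗[ℚ] V)}
    (hYskew : ∀ x y, ψ.form.baseChange ℂ (Y x) y + ψ.form.baseChange ℂ x (Y y) = 0) (u : Fin N → Fin k) :
    wordDerAt ℂ (fun _ : Fin N =>
      LinearMap.toMatrix (Algebra.TensorProduct.basis ℂ eQ) (Algebra.TensorProduct.basis ℂ eQ) Y)
      (wordSlice (fun w => algebraMap ℚ ℂ (q w)) u) = 0 := by
  -- the rational Lie algebra `𝔞 ⊆ 𝔰𝔭(V, ψ)` of `q`, with `E = End_Hdg(V)` as commuting family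
  set 𝔞 : Submodule ℚ (Module.End ℚ V) := annLie ψ.form eQ (fun a : H.endAlg => (a : Module.End ℚ V)) q
    with h𝔞
  have hΘC : Θ ∈ H.hodgeLieC := H.mem_hodgeLieC_of_forall_piece hΘ
  have hΘ𝔞 : Θ ∈ spanC 𝔞 :=
    mem_spanC_annLie ψ.form eQ _ q hΘq (fun a => commute_baseChange_of_mem_hodgeLieC H hΘC a)
      fun x y => by rw [formBaseChange_skew_of_mem_hodgeLieC ψ hΘC, neg_add_cancel]
  have hbr : ∀ X ∈ 𝔞, ∀ X' ∈ 𝔞, X * X' - X' * X ∈ 𝔞 := fun X hX X' hX' =>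
    commutator_mem_annLie ψ.form eQ _ q hX hX'
  have hskew : ∀ X ∈ 𝔞, ∀ v w, ψ.form (X v) w + ψ.form v (X w) = 0 :=
    fun X hX => ((mem_annLie_iff ψ.form eQ _ q X).1 hX).2.2
  have hY : Y ∈ spanC 𝔞 := SymplecticThetaSix.mem_spanC_of_skew H hn heff ψ hE hV 𝔞 hbr hΘ hΘ𝔞 hskew hYskew
  rw [h𝔞] at hY
  exact wordDerAt_eq_zero_of_mem_spanC_annLie ψ.form eQ _ q hY u

end AnnLie

end HodgeStructure

end Literature.AlgebraicGeometry.Motives
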